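import Summits.ResolutionOfSingularities.ResolutionOfSingularities.Theses.EquisingularLift
import Summits.ResolutionOfSingularities.ResolutionOfSingularities.Theorems.EquisingularLiftEquisingularLiftStrength
import Summits.ResolutionOfSingularities.ResolutionOfSingularities.Theorems.EquisingularLiftEquisingularLiftBankedLowDimension
import Summits.ResolutionOfSingularities.ResolutionOfSingularities.Theorems.EquisingularLiftCampaignW45bEquisingularLiftNatInstantiation
import HarnessLib

/-!
# `EquisingularLiftNat` (EL♮, stmt-ResolutionOfSingularities-20038) — DIMENSION BANDS: a lossless typed split and the
# kernel STRENGTH CERTIFICATE of the residual band `n ≥ 5`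

Route `Theses/EquisingularLift.lean` (rev 3, commit abeb47a3e810), crux chain w45b [OURS · L1 W4.5(b)], CRUX-STRATEGIST seat
res-L1-w45b-strat-1 (standing seat λ2 alongside the lead of the line `sections`). Support file for the crux item (`--supports`); it
closes nothing and does not touch the lead's skeleton `Lines/sections.lean` (stubs `stub_elnat_le_two` / `stub_elnat_three` /
`stub_elnat_ge_four`).

CONTENT (all sorry-free):
* `UpToThree p`, `Four p`, `FromFive p` — the route decl `Theses.EquisingularLift.EquisingularLiftNat` (text e7ca4a6668c5c33a =
  `∀ p, Theorems.EquisingularLiftNat p`) RESTRICTED BY AMBIENT DIMENSION (`n ≤ 3` / `n = 4` / `5 ≤ n`, the extra hypothesis inserted right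
  after the hypersurface hypothesis, everything else verbatim; `p` a parameter as in the o1 file, PARAM).
* `equisingularLiftNat_of_bands` / `bands_of_equisingularLiftNat` — the split is LOSSLESS: the three bands give the crux BY NAME and
  conversely (pure logic). This is the typed decomposition a tenure planner / the chain planner may promote with
  `ledger route edit … --split EquisingularLiftNat --into … --glue equisingularLiftNat_of_bands` (not executed by this seat).
* `elConclusion_of_natConclusion` — PER INSTANCE `(p, k, n, H, ι)`: the EL♮ conclusion block (fixed ambient `ℙⁿ_O`, E1 chains)
  gives the EL conclusion block (existential smooth proper ambient) — the instantiation of p483238 made local.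
* `hasResolution_of_elConclusion` — PER INSTANCE: the EL conclusion block for `H` gives `Scheme.HasResolution H`
  (`hasResolution_of_chain`, p165577, made local).
* `hasResolution_hypersurface_of_fromFive` — the residual band ALONE resolves every integral hypersurface of `ℙⁿ_k̄`, `n ≥ 5`
  (i.e. every projective hypersurface of dimension `≥ 4` over every algebraically closed field of characteristic `p > 0`).
* `equisingularLift_of_fromFive_of_CJS_CP` / `resolutionOverAlgClosed_of_fromFive_of_CJS_CP` — the residual band together with the
  three NAMED dimension-`≤ 3` literature facts already used by the banked EL files (`CossartJannsenSaito2020Sequence`,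
  `CossartPiltant2019General`, `CossartPiltant2019Principalization`) gives the whole original crux `EquisingularLift` and hence
  (p165577) resolution of EVERY reduced separated scheme of finite type over EVERY algebraically closed field of positive
  characteristic — the summit restricted to algebraically closed ground fields.

HONEST FRAMING. OURS bookkeeping + calibration inside the rescue branch of cell res-hironaka; nothing here is a statement of any
manuscript and nothing here is progress toward EL♮. The certificate makes kernel-exact the census words «≡ summit n ≥ 5»: the band
`FromFive` is at least as strong as the summit over `k̄` modulo the printed dimension-`≤ 3` theorems, so no line for it can be
"short of the summit"; the bands `UpToThree` (the line `sections`, research stub `n = 3`) and `Four` (threefold hypersurfaces in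
`ℙ⁴`: non-embedded resolution known, Cossart–Piltant; embedded resolution / ELU in dimension 4 open in print,
`Literature.Barriers.ResolutionOfSingularities.DimensionFourFrontier`) are the frontier-class pieces. No `sorry`; axioms standard.
-/

set_option linter.dupNamespace false -- mandated namespace of this single-conjunct summit

noncomputable section

open CategoryTheory CategoryTheory.Limits AlgebraicGeometry TopologicalSpace Topology
open MvPolynomial HomogeneousIdeal
open Literature.AlgebraicGeometry.Resolution
open AlgebraicGeometry.Scheme.IdealSheafData
open Summit.ResolutionOfSingularities.ResolutionOfSingularities.Cruxes.EquisingularLift.StrataSplit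
open Summit.ResolutionOfSingularities.ResolutionOfSingularities.Theses.EquisingularLift
open Summit.ResolutionOfSingularities.ResolutionOfSingularities.Theses.EquisingularLift.Split
open Summit.ResolutionOfSingularities.ResolutionOfSingularities.Theorems.EquisingularLift

namespace Summit.ResolutionOfSingularities.ResolutionOfSingularities.Theorems.EquisingularLiftNatBands

/-! ## The three dimension bands of EL♮ (verbatim restrictions of the route decl) -/

/-- [OURS · L1 W4.5(b)] **EL♮ band `n ≤ 3`** (points, `ℙ¹`, `ℙ²`, plane curves, `ℙ³`, surfaces in `ℙ³`): the route decl
`EquisingularLiftNat` at prime `p` with the extra hypothesis `n ≤ 3`; = `stub_elnat_le_two ∧ stub_elnat_three` of the line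
`sections`. Frontier-class (CJS port + liftable centres). NOT a statement of any manuscript. [folklore] -/
def UpToThree (p : ℕ) : Prop :=
  p.Prime → ∀ (k : Type) [Field k] [CharP k p] [IsAlgClosed k] (n : ℕ) (H : AlgebraicGeometry.Scheme.{0}) (ι : H ⟶ (Literature.AlgebraicGeometry.Motives.projectiveSpace n k).left), AlgebraicGeometry.IsClosedImmersion ι → AlgebraicGeometry.IsIntegral H → (∀ y : (Literature.AlgebraicGeometry.Motives.projectiveSpace n k).left, ∃ U : (Literature.AlgebraicGeometry.Motives.projectiveSpace n k).left.affineOpens, y ∈ (U : (Literature.AlgebraicGeometry.Motives.projectiveSpace n k).left.Opens) ∧ (ι.ker.ideal U).IsPrincipal) → n ≤ 3 → ∃ (O : Type) (_ : CommRing O) (_ : IsDomain O) (_ : IsDiscreteValuationRing O) (_ : CharZero O) (π : O →+* k), Function.Surjective π ∧ (letI := MvPolynomial.gradedAlgebra (σ := Fin (n + 1)) (R := O); letI := MvPolynomial.gradedAlgebra (σ := Fin (n + 1)) (R := k); ∀ (φ : MvPolynomial.homogeneousSubmodule (Fin (n + 1)) O →+*ᵍ MvPolynomial.homogeneousSubmodule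 (Fin (n + 1)) k) (hφ' : HomogeneousIdeal.irrelevant (MvPolynomial.homogeneousSubmodule (Fin (n + 1)) k) ≤ (HomogeneousIdeal.irrelevant (MvPolynomial.homogeneousSubmodule (Fin (n + 1)) O)).map φ), (∀ s, φ s = MvPolynomial.map π s) → ∀ Y : Set (AlgebraicGeometry.Proj (MvPolynomial.homogeneousSubmodule (Fin (n + 1)) O)), Y = Set.range (CategoryTheory.CategoryStruct.comp ι (AlgebraicGeometry.Proj.map φ hφ') : H ⟶ (AlgebraicGeometry.Proj (MvPolynomial.homogeneousSubmodule (Fin (n + 1)) O))) → ∃ (P' : AlgebraicGeometry.Scheme.{0}) (σ : P' ⟶ (AlgebraicGeometry.Proj (MvPolynomial.homogeneousSubmodule (Fin (n + 1)) O))) (S' : Set P'), (∀ Q : (∀ X' : AlgebraicGeometry.Scheme.{0}, (X' ⟶ (AlgebraicGeometry.Proj (MvPolynomial.homogeneousSubmodule (Fin (n + 1)) O))) → Set X' → Prop), Q (AlgebraicGeometry.Proj (MvPolynomial.homogeneousSubmodule (Fin (n + 1)) O)) (CategoryTheory.CategoryStruct.id _) Y → (∀ (X' X'' : AlgebraicGeometry.Scheme.{0})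 (σ' : X' ⟶ (AlgebraicGeometry.Proj (MvPolynomial.homogeneousSubmodule (Fin (n + 1)) O))) (Y' : Set X') (C : X'.IdealSheafData) (τ : X'' ⟶ X'), Q X' σ' Y' → Literature.AlgebraicGeometry.Resolution.IsBlowup τ C → Literature.AlgebraicGeometry.Resolution.Scheme.IsRegular C.subscheme → σ' '' (C.support : Set X') ⊆ {x | ¬ IsGenericPoint x Y} → (C.support : Set X') ∩ (CategoryTheory.CategoryStruct.comp σ' (CategoryTheory.CategoryStruct.comp (AlgebraicGeometry.Proj.toSpecZero (MvPolynomial.homogeneousSubmodule (Fin (n + 1)) O)) (AlgebraicGeometry.Spec.map (CommRingCat.ofHom (algebraMap O (MvPolynomial.homogeneousSubmodule (Fin (n + 1)) O 0)))))) ⁻¹' {IsLocalRing.closedPoint O} ⊆ Y' → Q X'' (CategoryTheory.CategoryStruct.comp τ σ') (closure (τ ⁻¹' (Y' \ (C.support : Set X'))))) → Q P' σ S') ∧ IsIrreducible ((CategoryTheory.CategoryStruct.comp σ (CategoryTheory.CategoryStruct.comp (AlgebraicGeometry.Proj.toSpecZero (MvPolynomial.homogeneousSubmodule (Fin (n + 1))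 O)) (AlgebraicGeometry.Spec.map (CommRingCat.ofHom (algebraMap O (MvPolynomial.homogeneousSubmodule (Fin (n + 1)) O 0)))))) ⁻¹' {IsLocalRing.closedPoint O}) ∧ Literature.AlgebraicGeometry.Resolution.Scheme.IsRegular (AlgebraicGeometry.Scheme.IdealSheafData.vanishingIdeal (⟨closure S', isClosed_closure⟩ : TopologicalSpace.Closeds P')).subscheme)

/-- [OURS · L1 W4.5(b)] **EL♮ band `n = 4`** (threefold hypersurfaces in `ℙ⁴`): the route decl `EquisingularLiftNat` at prime `p`
with the extra hypothesis `n = 4`. Its non-embedded shadow (resolution of `H`) is KNOWN (Cossart–Piltant 2019); its embedded /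
lifting content is beyond print (ELU in dimension 4 open: `Literature.Barriers.ResolutionOfSingularities.DimensionFourFrontier`).
NOT a statement of any manuscript. [folklore] -/
def Four (p : ℕ) : Prop :=
  p.Prime → ∀ (k : Type) [Field k] [CharP k p] [IsAlgClosed k] (n : ℕ) (H : AlgebraicGeometry.Scheme.{0}) (ι : H ⟶ (Literature.AlgebraicGeometry.Motives.projectiveSpace n k).left), AlgebraicGeometry.IsClosedImmersion ι → AlgebraicGeometry.IsIntegral H → (∀ y : (Literature.AlgebraicGeometry.Motives.projectiveSpace n k).left, ∃ U : (Literature.AlgebraicGeometry.Motives.projectiveSpace n k).left.affineOpens, y ∈ (U : (Literature.AlgebraicGeometry.Motives.projectiveSpace n k).left.Opens) ∧ (ι.ker.ideal U).IsPrincipal) → n = 4 → ∃ (O : Type) (_ : CommRing O) (_ : IsDomain O) (_ : IsDiscreteValuationRing O) (_ : CharZero O) (π : O →+* k), Function.Surjective π ∧ (letI := MvPolynomial.gradedAlgebra (σ := Fin (n + 1)) (R := O); letI := MvPolynomial.gradedAlgebra (σ := Fin (n + 1)) (R := k); ∀ (φ : MvPolynomial.homogeneousSubmodule (Fin (n + 1))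 O →+*ᵍ MvPolynomial.homogeneousSubmodule (Fin (n + 1)) k) (hφ' : HomogeneousIdeal.irrelevant (MvPolynomial.homogeneousSubmodule (Fin (n + 1)) k) ≤ (HomogeneousIdeal.irrelevant (MvPolynomial.homogeneousSubmodule (Fin (n + 1)) O)).map φ), (∀ s, φ s = MvPolynomial.map π s) → ∀ Y : Set (AlgebraicGeometry.Proj (MvPolynomial.homogeneousSubmodule (Fin (n + 1)) O)), Y = Set.range (CategoryTheory.CategoryStruct.comp ι (AlgebraicGeometry.Proj.map φ hφ') : H ⟶ (AlgebraicGeometry.Proj (MvPolynomial.homogeneousSubmodule (Fin (n + 1)) O))) → ∃ (P' : AlgebraicGeometry.Scheme.{0}) (σ : P' ⟶ (AlgebraicGeometry.Proj (MvPolynomial.homogeneousSubmodule (Fin (n + 1)) O))) (S' : Set P'), (∀ Q : (∀ X' : AlgebraicGeometry.Scheme.{0}, (X' ⟶ (AlgebraicGeometry.Proj (MvPolynomial.homogeneousSubmodule (Fin (n + 1)) O))) → Set X' → Prop), Q (AlgebraicGeometry.Proj (MvPolynomial.homogeneousSubmodule (Fin (n + 1)) O)) (CategoryTheory.CategoryStruct.id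 _) Y → (∀ (X' X'' : AlgebraicGeometry.Scheme.{0}) (σ' : X' ⟶ (AlgebraicGeometry.Proj (MvPolynomial.homogeneousSubmodule (Fin (n + 1)) O))) (Y' : Set X') (C : X'.IdealSheafData) (τ : X'' ⟶ X'), Q X' σ' Y' → Literature.AlgebraicGeometry.Resolution.IsBlowup τ C → Literature.AlgebraicGeometry.Resolution.Scheme.IsRegular C.subscheme → σ' '' (C.support : Set X') ⊆ {x | ¬ IsGenericPoint x Y} → (C.support : Set X') ∩ (CategoryTheory.CategoryStruct.comp σ' (CategoryTheory.CategoryStruct.comp (AlgebraicGeometry.Proj.toSpecZero (MvPolynomial.homogeneousSubmodule (Fin (n + 1)) O)) (AlgebraicGeometry.Spec.map (CommRingCat.ofHom (algebraMap O (MvPolynomial.homogeneousSubmodule (Fin (n + 1)) O 0)))))) ⁻¹' {IsLocalRing.closedPoint O} ⊆ Y' → Q X'' (CategoryTheory.CategoryStruct.comp τ σ') (closure (τ ⁻¹' (Y' \ (C.support : Set X'))))) → Q P' σ S') ∧ IsIrreducible ((CategoryTheory.CategoryStruct.comp σ (CategoryTheory.CategoryStruct.comp (AlgebraicGeometry.Proj.toSpecZero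 (MvPolynomial.homogeneousSubmodule (Fin (n + 1)) O)) (AlgebraicGeometry.Spec.map (CommRingCat.ofHom (algebraMap O (MvPolynomial.homogeneousSubmodule (Fin (n + 1)) O 0)))))) ⁻¹' {IsLocalRing.closedPoint O}) ∧ Literature.AlgebraicGeometry.Resolution.Scheme.IsRegular (AlgebraicGeometry.Scheme.IdealSheafData.vanishingIdeal (⟨closure S', isClosed_closure⟩ : TopologicalSpace.Closeds P')).subscheme)

/-- [OURS · L1 W4.5(b)] **EL♮ band `n ≥ 5`** (hypersurfaces of dimension `≥ 4`): the route decl `EquisingularLiftNat` at prime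
`p` with the extra hypothesis `5 ≤ n` — THE RESIDUAL. At least as strong as the summit over `k̄` modulo the dimension-`≤ 3`
literature (`resolutionOverAlgClosed_of_fromFive_of_CJS_CP` below). NOT a statement of any manuscript. [folklore] -/
def FromFive (p : ℕ) : Prop :=
  p.Prime → ∀ (k : Type) [Field k] [CharP k p] [IsAlgClosed k] (n : ℕ) (H : AlgebraicGeometry.Scheme.{0}) (ι : H ⟶ (Literature.AlgebraicGeometry.Motives.projectiveSpace n k).left), AlgebraicGeometry.IsClosedImmersion ι → AlgebraicGeometry.IsIntegral H → (∀ y : (Literature.AlgebraicGeometry.Motives.projectiveSpace n k).left, ∃ U : (Literature.AlgebraicGeometry.Motives.projectiveSpace n k).left.affineOpens, y ∈ (U : (Literature.AlgebraicGeometry.Motives.projectiveSpace n k).left.Opens) ∧ (ι.ker.ideal U).IsPrincipal) → 5 ≤ n → ∃ (O : Type) (_ : CommRing O) (_ : IsDomain O) (_ : IsDiscreteValuationRing O) (_ : CharZero O) (π : O →+* k), Function.Surjective π ∧ (letI := MvPolynomial.gradedAlgebra (σ := Fin (n + 1)) (R := O); letI := MvPolynomial.gradedAlgebra (σ := Fin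 (n + 1)) (R := k); ∀ (φ : MvPolynomial.homogeneousSubmodule (Fin (n + 1)) O →+*ᵍ MvPolynomial.homogeneousSubmodule (Fin (n + 1)) k) (hφ' : HomogeneousIdeal.irrelevant (MvPolynomial.homogeneousSubmodule (Fin (n + 1)) k) ≤ (HomogeneousIdeal.irrelevant (MvPolynomial.homogeneousSubmodule (Fin (n + 1)) O)).map φ), (∀ s, φ s = MvPolynomial.map π s) → ∀ Y : Set (AlgebraicGeometry.Proj (MvPolynomial.homogeneousSubmodule (Fin (n + 1)) O)), Y = Set.range (CategoryTheory.CategoryStruct.comp ι (AlgebraicGeometry.Proj.map φ hφ') : H ⟶ (AlgebraicGeometry.Proj (MvPolynomial.homogeneousSubmodule (Fin (n + 1)) O))) → ∃ (P' : AlgebraicGeometry.Scheme.{0}) (σ : P' ⟶ (AlgebraicGeometry.Proj (MvPolynomial.homogeneousSubmodule (Fin (n + 1)) O))) (S' : Set P'), (∀ Q : (∀ X' : AlgebraicGeometry.Scheme.{0}, (X' ⟶ (AlgebraicGeometry.Proj (MvPolynomial.homogeneousSubmodule (Fin (n + 1)) O))) → Set X' → Prop), Q (AlgebraicGeometry.Proj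 (MvPolynomial.homogeneousSubmodule (Fin (n + 1)) O)) (CategoryTheory.CategoryStruct.id _) Y → (∀ (X' X'' : AlgebraicGeometry.Scheme.{0}) (σ' : X' ⟶ (AlgebraicGeometry.Proj (MvPolynomial.homogeneousSubmodule (Fin (n + 1)) O))) (Y' : Set X') (C : X'.IdealSheafData) (τ : X'' ⟶ X'), Q X' σ' Y' → Literature.AlgebraicGeometry.Resolution.IsBlowup τ C → Literature.AlgebraicGeometry.Resolution.Scheme.IsRegular C.subscheme → σ' '' (C.support : Set X') ⊆ {x | ¬ IsGenericPoint x Y} → (C.support : Set X') ∩ (CategoryTheory.CategoryStruct.comp σ' (CategoryTheory.CategoryStruct.comp (AlgebraicGeometry.Proj.toSpecZero (MvPolynomial.homogeneousSubmodule (Fin (n + 1)) O)) (AlgebraicGeometry.Spec.map (CommRingCat.ofHom (algebraMap O (MvPolynomial.homogeneousSubmodule (Fin (n + 1)) O 0)))))) ⁻¹' {IsLocalRing.closedPoint O} ⊆ Y' → Q X'' (CategoryTheory.CategoryStruct.comp τ σ') (closure (τ ⁻¹' (Y' \ (C.support : Set X'))))) → Q P' σ S') ∧ IsIrreducible ((CategoryTheory.CategoryStruct.comp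 σ (CategoryTheory.CategoryStruct.comp (AlgebraicGeometry.Proj.toSpecZero (MvPolynomial.homogeneousSubmodule (Fin (n + 1)) O)) (AlgebraicGeometry.Spec.map (CommRingCat.ofHom (algebraMap O (MvPolynomial.homogeneousSubmodule (Fin (n + 1)) O 0)))))) ⁻¹' {IsLocalRing.closedPoint O}) ∧ Literature.AlgebraicGeometry.Resolution.Scheme.IsRegular (AlgebraicGeometry.Scheme.IdealSheafData.vanishingIdeal (⟨closure S', isClosed_closure⟩ : TopologicalSpace.Closeds P')).subscheme)

/-! ## The split is lossless (pure logic) -/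

/-- **Typed decomposition of the crux**: the three bands give the route decl `EquisingularLiftNat` BY NAME. [folklore] -/
theorem equisingularLiftNat_of_bands (h3 : ∀ p : ℕ, UpToThree p) (h4 : ∀ p : ℕ, Four p) (h5 : ∀ p : ℕ, FromFive p) :
    Summit.ResolutionOfSingularities.ResolutionOfSingularities.Theses.EquisingularLift.EquisingularLiftNat := by
  intro p hp k _ _ _ n H ι hι hH hloc
  rcases Nat.lt_or_ge n 4 with h | h
  · exact h3 p hp k n H ι hι hH hloc (by omega)
  · rcases Nat.eq_or_lt_of_le h with h' | h'
    · exact h4 p hp k n H ι hι hH hloc h'.symm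
    · exact h5 p hp k n H ι hι hH hloc (by omega)

/-- Converse (losslessness): the crux gives each band. [folklore] -/
theorem bands_of_equisingularLiftNat
    (h : Summit.ResolutionOfSingularities.ResolutionOfSingularities.Theses.EquisingularLift.EquisingularLiftNat) :
    (∀ p : ℕ, UpToThree p) ∧ (∀ p : ℕ, Four p) ∧ (∀ p : ℕ, FromFive p) :=
  ⟨fun p hp k _ _ _ n H ι hι hH hloc _ => h p hp k n H ι hι hH hloc,
   fun p hp k _ _ _ n H ι hι hH hloc _ => h p hp k n H ι hι hH hloc,
   fun p hp k _ _ _ n H ι hι hH hloc _ => h p hp k n H ι hι hH hloc⟩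

/-! ## Per-instance instantiation: the EL♮ conclusion block gives the EL conclusion block -/

/-- **EL♮ ⇒ EL, one hypersurface at a time.** For a fixed instance `(p, k, n, H, ι)` the conclusion block of
`EquisingularLiftNat` (fixed ambient `ℙⁿ_O = Proj O[x₀..xₙ]`, `Y = range (ι ≫ Proj.map (map π))`, E1 chains) gives the conclusion
block of `EquisingularLift` (existential smooth proper ambient, `V(Y) ≅ H`, chains without E1): the argument of
`equisingularLift_of_equisingularLiftNatA` (p483238) with the instance held fixed. [folklore] -/
theorem elConclusion_of_natConclusion (p : ℕ) (k : Type) [Field k] [CharP k p] [IsAlgClosed k] (n : ℕ) (H : AlgebraicGeometry.Scheme.{0}) (ι : H ⟶ (Literature.AlgebraicGeometry.Motives.projectiveSpace n k).left) (hι : AlgebraicGeometry.IsClosedImmersion ι) (hH : AlgebraicGeometry.IsIntegral H) :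
    (∃ (O : Type) (_ : CommRing O) (_ : IsDomain O) (_ : IsDiscreteValuationRing O) (_ : CharZero O) (π : O →+* k), Function.Surjective π ∧ (letI := MvPolynomial.gradedAlgebra (σ := Fin (n + 1)) (R := O); letI := MvPolynomial.gradedAlgebra (σ := Fin (n + 1)) (R := k); ∀ (φ : MvPolynomial.homogeneousSubmodule (Fin (n + 1)) O →+*ᵍ MvPolynomial.homogeneousSubmodule (Fin (n + 1)) k) (hφ' : HomogeneousIdeal.irrelevant (MvPolynomial.homogeneousSubmodule (Fin (n + 1)) k) ≤ (HomogeneousIdeal.irrelevant (MvPolynomial.homogeneousSubmodule (Fin (n + 1)) O)).map φ), (∀ s, φ s = MvPolynomial.map π s) → ∀ Y : Set (AlgebraicGeometry.Proj (MvPolynomial.homogeneousSubmodule (Fin (n + 1)) O)), Y = Set.range (CategoryTheory.CategoryStruct.comp ι (AlgebraicGeometry.Proj.map φ hφ') : H ⟶ (AlgebraicGeometry.Proj (MvPolynomial.homogeneousSubmodule (Fin (n + 1)) O))) → ∃ (P' : AlgebraicGeometry.Scheme.{0}) (σ : P' ⟶ (AlgebraicGeometry.Proj (MvPolynomial.homogeneousSubmodule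 (Fin (n + 1)) O))) (S' : Set P'), (∀ Q : (∀ X' : AlgebraicGeometry.Scheme.{0}, (X' ⟶ (AlgebraicGeometry.Proj (MvPolynomial.homogeneousSubmodule (Fin (n + 1)) O))) → Set X' → Prop), Q (AlgebraicGeometry.Proj (MvPolynomial.homogeneousSubmodule (Fin (n + 1)) O)) (CategoryTheory.CategoryStruct.id _) Y → (∀ (X' X'' : AlgebraicGeometry.Scheme.{0}) (σ' : X' ⟶ (AlgebraicGeometry.Proj (MvPolynomial.homogeneousSubmodule (Fin (n + 1)) O))) (Y' : Set X') (C : X'.IdealSheafData) (τ : X'' ⟶ X'), Q X' σ' Y' → Literature.AlgebraicGeometry.Resolution.IsBlowup τ C → Literature.AlgebraicGeometry.Resolution.Scheme.IsRegular C.subscheme → σ' '' (C.support : Set X') ⊆ {x | ¬ IsGenericPoint x Y} → (C.support : Set X') ∩ (CategoryTheory.CategoryStruct.comp σ' (CategoryTheory.CategoryStruct.comp (AlgebraicGeometry.Proj.toSpecZero (MvPolynomial.homogeneousSubmodule (Fin (n + 1)) O)) (AlgebraicGeometry.Spec.map (CommRingCat.ofHom (algebraMap O (MvPolynomial.homogeneousSubmodule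 (Fin (n + 1)) O 0)))))) ⁻¹' {IsLocalRing.closedPoint O} ⊆ Y' → Q X'' (CategoryTheory.CategoryStruct.comp τ σ') (closure (τ ⁻¹' (Y' \ (C.support : Set X'))))) → Q P' σ S') ∧ IsIrreducible ((CategoryTheory.CategoryStruct.comp σ (CategoryTheory.CategoryStruct.comp (AlgebraicGeometry.Proj.toSpecZero (MvPolynomial.homogeneousSubmodule (Fin (n + 1)) O)) (AlgebraicGeometry.Spec.map (CommRingCat.ofHom (algebraMap O (MvPolynomial.homogeneousSubmodule (Fin (n + 1)) O 0)))))) ⁻¹' {IsLocalRing.closedPoint O}) ∧ Literature.AlgebraicGeometry.Resolution.Scheme.IsRegular (AlgebraicGeometry.Scheme.IdealSheafData.vanishingIdeal (⟨closure S', isClosed_closure⟩ : TopologicalSpace.Closeds P')).subscheme)) →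
    ∃ (O : Type) (_ : CommRing O) (_ : IsDomain O) (_ : IsDiscreteValuationRing O) (_ : CharZero O) (P P' : AlgebraicGeometry.Scheme.{0}) (q : P ⟶ AlgebraicGeometry.Spec (.of O)) (Y : TopologicalSpace.Closeds P) (σ : P' ⟶ P) (S' : Set P'), AlgebraicGeometry.Smooth q ∧ AlgebraicGeometry.IsProper q ∧ (Y : Set P) ⊆ q ⁻¹' {IsLocalRing.closedPoint O} ∧ Nonempty ((AlgebraicGeometry.Scheme.IdealSheafData.vanishingIdeal Y).subscheme ≅ H) ∧ (∀ Q : (∀ X' : AlgebraicGeometry.Scheme.{0}, (X' ⟶ P) → Set X' → Prop), Q P (CategoryTheory.CategoryStruct.id P) (Y : Set P) → (∀ (X' X'' : AlgebraicGeometry.Scheme.{0}) (σ' : X' ⟶ P) (Y' : Set X') (C : X'.IdealSheafData) (τ : X'' ⟶ X'), Q X' σ' Y' → Literature.AlgebraicGeometry.Resolution.IsBlowup τ C → Literature.AlgebraicGeometry.Resolution.Scheme.IsRegular C.subscheme → σ' '' (C.support : Set X') ⊆ {x : P | ¬ IsGenericPoint x (Y : Set P)} → Q X'' (CategoryTheory.CategoryStruct.comp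 τ σ') (closure (τ ⁻¹' (Y' \ (C.support : Set X'))))) → Q P' σ S') ∧ IsIrreducible ((CategoryTheory.CategoryStruct.comp σ q) ⁻¹' {IsLocalRing.closedPoint O}) ∧ Literature.AlgebraicGeometry.Resolution.Scheme.IsRegular (AlgebraicGeometry.Scheme.IdealSheafData.vanishingIdeal (⟨closure S', isClosed_closure⟩ : TopologicalSpace.Closeds P')).subscheme := by
  intro h
  obtain ⟨O, i1, i2, i3, i4, π, hπ, h'⟩ := h
  -- the gradings by degree (Mathlib abbrevs, not instances; the statement carries them as `letI`)
  letI := MvPolynomial.gradedAlgebra (σ := Fin (n + 1)) (R := O)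
  letI := MvPolynomial.gradedAlgebra (σ := Fin (n + 1)) (R := k)
  -- the graded base-change map `O[x] → k[x]` and the comparison `g : ℙⁿ_k ⟶ ℙⁿ_O`
  let φ : homogeneousSubmodule (Fin (n + 1)) O →+*ᵍ homogeneousSubmodule (Fin (n + 1)) k :=
    ⟨MvPolynomial.map π, fun h ↦ h.map π⟩
  have hφ : ∀ s, φ s = MvPolynomial.map π s := fun _ ↦ rfl
  have hφ' := ProjectiveAmbientFibre.irrelevant_le_map_gradedMap π φ hφ
  obtain ⟨P', σ, S', hchain, hirr, hreg⟩ := h' φ hφ' hφ _ rfl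
  have hP := ProjectiveAmbientFibre.isPullback_projMap π φ hφ hπ hφ'
  set q : Proj (homogeneousSubmodule (Fin (n + 1)) O) ⟶ Spec (.of O) :=
    Proj.toSpecZero (homogeneousSubmodule (Fin (n + 1)) O) ≫
      Spec.map (CommRingCat.ofHom (algebraMap O (homogeneousSubmodule (Fin (n + 1)) O 0))) with hq
  set g : Proj (homogeneousSubmodule (Fin (n + 1)) k) ⟶ Proj (homogeneousSubmodule (Fin (n + 1)) O) :=
    Proj.map φ hφ' with hg
  -- `g` is a closed immersion onto the special fibre
  haveI : IsClosedImmersion (Spec.map (CommRingCat.ofHom π)) := IsClosedImmersion.spec_of_surjective _ hπ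
  haveI : IsClosedImmersion g := MorphismProperty.IsStableUnderBaseChange.of_isPullback hP.flip inferInstance
  have hpt : ∀ x : Spec (.of k), Spec.map (CommRingCat.ofHom π) x = IsLocalRing.closedPoint O := by
    intro x
    rw [Spec.map_apply]
    apply PrimeSpectrum.ext
    rw [PrimeSpectrum.comap_asIdeal, CommRingCat.hom_ofHom, Ideal.eq_bot_of_prime x.asIdeal, ← RingHom.ker_eq_comap_bot]
    exact IsLocalRing.eq_maximalIdeal (RingHom.ker_isMaximal_of_surjective π hπ)
  have hgq : ∀ x, q (g x) = IsLocalRing.closedPoint O := fun x ↦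
    (Scheme.Hom.comp_apply g q x).symm.trans
      ((congrArg (fun h : Proj (homogeneousSubmodule (Fin (n + 1)) k) ⟶ Spec (.of O) ↦ h x) hP.w).trans
        ((Scheme.Hom.comp_apply _ _ x).trans (hpt _)))
  -- the closed immersion `f = ι ≫ g : H ⟶ ℙⁿ_O` and its range `Y`
  haveI := hH
  let ι' : H ⟶ Proj (homogeneousSubmodule (Fin (n + 1)) k) := ι
  haveI : IsClosedImmersion ι' := hι
  let f : H ⟶ Proj (homogeneousSubmodule (Fin (n + 1)) O) := ι' ≫ g
  let Y : Closeds (Proj (homogeneousSubmodule (Fin (n + 1)) O)) := ⟨Set.range f, f.isClosedEmbedding.isClosed_range⟩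
  have hsub : Set.range f ⊆ q ⁻¹' {IsLocalRing.closedPoint O} := by
    rintro _ ⟨x, rfl⟩
    show q (f x) = IsLocalRing.closedPoint O
    rw [show f x = g (ι' x) from Scheme.Hom.comp_apply _ _ x]
    exact hgq (ι' x)
  obtain ⟨hsm, hprop⟩ := stub_projectiveAmbientSmoothProper O n
  refine ⟨O, i1, i2, i3, i4, Proj (homogeneousSubmodule (Fin (n + 1)) O), P', q, Y, σ, S', hsm, hprop, hsub, ?_, ?_,
    hirr, hreg⟩
  · -- `H` is reduced, so the kernel of the closed immersion `f` is the vanishing ideal sheaf of its range `Y`,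
    -- which is also the kernel of `V(Y) ↪ ℙⁿ_O` (p160143's argument)
    have hYker : Scheme.IdealSheafData.vanishingIdeal Y = f.ker := by
      rw [← Scheme.IdealSheafData.map_bot, ← Scheme.nilradical_eq_bot, ← Scheme.IdealSheafData.vanishingIdeal_top,
        Scheme.IdealSheafData.map_vanishingIdeal]
      congr 1
      ext1
      change Set.range f = closure (f '' Set.univ)
      rw [Set.image_univ, f.isClosedEmbedding.isClosed_range.closure_eq]
    have hker : (Scheme.IdealSheafData.vanishingIdeal Y).subschemeι.ker = f.ker := by
      rw [Scheme.IdealSheafData.ker_subschemeι, hYker]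
    haveI := IsClosedImmersion.isIso_lift _ f hker
    exact ⟨(asIso (IsClosedImmersion.lift _ f hker.le)).symm⟩
  · -- an E1 chain (closure of `Q` under FEWER steps) is a chain
    intro Q hQ0 hstep
    exact hchain Q hQ0 (fun X' X'' σ' Y' C τ hQ hbl hC hgen _hE1 => hstep X' X'' σ' Y' C τ hQ hbl hC hgen)

/-! ## Per-instance strength: the EL conclusion block resolves `H` -/

/-- **EL resolves its hypersurface, one at a time.** For a fixed instance the conclusion block of `EquisingularLift` for the
integral `H` gives `Scheme.HasResolution H`: `V(Y) ≅ H` embeds `H` in the locally Noetherian `P` with range `Y`, and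
`hasResolution_of_chain` (p165577) applies. [folklore] -/
theorem hasResolution_of_elConclusion (H : AlgebraicGeometry.Scheme.{0}) (hH : AlgebraicGeometry.IsIntegral H) :
    (∃ (O : Type) (_ : CommRing O) (_ : IsDomain O) (_ : IsDiscreteValuationRing O) (_ : CharZero O) (P P' : AlgebraicGeometry.Scheme.{0}) (q : P ⟶ AlgebraicGeometry.Spec (.of O)) (Y : TopologicalSpace.Closeds P) (σ : P' ⟶ P) (S' : Set P'), AlgebraicGeometry.Smooth q ∧ AlgebraicGeometry.IsProper q ∧ (Y : Set P) ⊆ q ⁻¹' {IsLocalRing.closedPoint O} ∧ Nonempty ((AlgebraicGeometry.Scheme.IdealSheafData.vanishingIdeal Y).subscheme ≅ H) ∧ (∀ Q : (∀ X' : AlgebraicGeometry.Scheme.{0}, (X' ⟶ P) → Set X' → Prop), Q P (CategoryTheory.CategoryStruct.id P) (Y : Set P) → (∀ (X' X'' : AlgebraicGeometry.Scheme.{0}) (σ' : X' ⟶ P) (Y' : Set X') (C : X'.IdealSheafData) (τ : X'' ⟶ X'), Q X' σ' Y' → Literature.AlgebraicGeometry.Resolution.IsBlowup τ C → Literature.AlgebraicGeometry.Resolution.Scheme.IsRegular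 C.subscheme → σ' '' (C.support : Set X') ⊆ {x : P | ¬ IsGenericPoint x (Y : Set P)} → Q X'' (CategoryTheory.CategoryStruct.comp τ σ') (closure (τ ⁻¹' (Y' \ (C.support : Set X'))))) → Q P' σ S') ∧ IsIrreducible ((CategoryTheory.CategoryStruct.comp σ q) ⁻¹' {IsLocalRing.closedPoint O}) ∧ Literature.AlgebraicGeometry.Resolution.Scheme.IsRegular (AlgebraicGeometry.Scheme.IdealSheafData.vanishingIdeal (⟨closure S', isClosed_closure⟩ : TopologicalSpace.Closeds P')).subscheme) →
    Literature.AlgebraicGeometry.Resolution.Scheme.HasResolution H := by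
  intro h
  obtain ⟨O, _, _, _, _, P, P', q, Y, σ, S', hq, _, _, ⟨e⟩, hET, _, hreg⟩ := h
  haveI := hq
  haveI := hH
  haveI : IsLocallyNoetherian P := LocallyOfFiniteType.isLocallyNoetherian q
  let ι₀ : H ⟶ P := CategoryStruct.comp e.inv (vanishingIdeal Y).subschemeι
  haveI : IsClosedImmersion ι₀ := inferInstance
  have hrange : Set.range ι₀ = (Y : Set P) := by
    rw [← Scheme.IdealSheafData.coe_support_vanishingIdeal Y, ← Scheme.IdealSheafData.range_subschemeι]
    ext x
    constructor
    · rintro ⟨h, rfl⟩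
      exact ⟨e.inv h, (Scheme.Hom.comp_apply _ _ h).symm⟩
    · rintro ⟨y, rfl⟩
      obtain ⟨h, rfl⟩ := e.inv.surjective y
      exact ⟨h, Scheme.Hom.comp_apply _ _ h⟩
  have hch : Chain P (Set.range ι₀) P' σ S' := by
    rw [hrange]
    exact hET
  exact hasResolution_of_chain P P' H ι₀ σ S' hch hreg

/-! ## The residual band `n ≥ 5`: strength certificate -/

/-- **The residual band alone resolves every hypersurface of dimension `≥ 4`.** `FromFive` ⟹ for every prime `p`, every
algebraically closed `k` of characteristic `p`, every `n ≥ 5` and every integral closed `H ⊆ ℙⁿ_k` with locally principal ideal: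
`H` has a resolution of singularities — a statement OPEN in print (resolution in dimension `≥ 4`, positive characteristic:
`Literature.Barriers.ResolutionOfSingularities.DimensionFourFrontier`). Calibration, not progress. [folklore] -/
theorem hasResolution_hypersurface_of_fromFive (h5 : ∀ p : ℕ, FromFive p) :
    ∀ p : ℕ, p.Prime → ∀ (k : Type) [Field k] [CharP k p] [IsAlgClosed k] (n : ℕ) (H : AlgebraicGeometry.Scheme.{0}) (ι : H ⟶ (Literature.AlgebraicGeometry.Motives.projectiveSpace n k).left), AlgebraicGeometry.IsClosedImmersion ι → AlgebraicGeometry.IsIntegral H → (∀ y : (Literature.AlgebraicGeometry.Motives.projectiveSpace n k).left, ∃ U : (Literature.AlgebraicGeometry.Motives.projectiveSpace n k).left.affineOpens, y ∈ (U : (Literature.AlgebraicGeometry.Motives.projectiveSpace n k).left.Opens) ∧ (ι.ker.ideal U).IsPrincipal) → 5 ≤ n → Literature.AlgebraicGeometry.Resolution.Scheme.HasResolution H := by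
  intro p hp k _ _ _ n H ι hι hH hloc hn
  exact hasResolution_of_elConclusion H hH
    (elConclusion_of_natConclusion p k n H ι hι hH (h5 p hp k n H ι hι hH hloc hn))

/-- **The band `n = 4` resolves threefold hypersurfaces** — a KNOWN conclusion (Cossart–Piltant 2019), recorded so that the
calibration of the three bands is complete: the excess of `Four` over print is its embedded / lifting content only. [folklore] -/
theorem hasResolution_hypersurface_of_four (h4 : ∀ p : ℕ, Four p) :
    ∀ p : ℕ, p.Prime → ∀ (k : Type) [Field k] [CharP k p] [IsAlgClosed k] (n : ℕ) (H : AlgebraicGeometry.Scheme.{0}) (ι : H ⟶ (Literature.AlgebraicGeometry.Motives.projectiveSpace n k).left), AlgebraicGeometry.IsClosedImmersion ι → AlgebraicGeometry.IsIntegral H → (∀ y : (Literature.AlgebraicGeometry.Motives.projectiveSpace n k).left, ∃ U : (Literature.AlgebraicGeometry.Motives.projectiveSpace n k).left.affineOpens, y ∈ (U : (Literature.AlgebraicGeometry.Motives.projectiveSpace n k).left.Opens) ∧ (ι.ker.ideal U).IsPrincipal) → n = 4 → Literature.AlgebraicGeometry.Resolution.Scheme.HasResolution H := by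
  intro p hp k _ _ _ n H ι hι hH hloc hn
  exact hasResolution_of_elConclusion H hH
    (elConclusion_of_natConclusion p k n H ι hι hH (h4 p hp k n H ι hι hH hloc hn))

/-- **Residual band + dimension-`≤ 3` literature ⟹ the original crux EL.** With the three named facts already consumed by the
banked files (`equisingularLift_le_four_of_CJS_CP`, p479009/p477552/p171618: Cossart–Jannsen–Saito 2020 embedded surfaces,
Cossart–Piltant 2019 threefolds + principalization), the band `FromFive` gives `Theses.EquisingularLift.EquisingularLift` in
all dimensions (`n ≤ 4` banked, `n ≥ 5` instantiated). [folklore] -/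
theorem equisingularLift_of_fromFive_of_CJS_CP (hCJS : CossartJannsenSaito2020Sequence.{0})
    (hCP : CossartPiltant2019General.{0}) (hPr : CossartPiltant2019Principalization.{0}) (h5 : ∀ p : ℕ, FromFive p) :
    Summit.ResolutionOfSingularities.ResolutionOfSingularities.Theses.EquisingularLift.EquisingularLift := by
  intro p hp k _ _ _ n H ι hι hH hloc
  by_cases hn : n ≤ 4
  · exact equisingularLift_le_four_of_CJS_CP hCJS hCP hPr p hp k n H ι hι hH hloc hn
  · exact elConclusion_of_natConclusion p k n H ι hι hH (h5 p hp k n H ι hι hH hloc (by omega))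

/-- **STRENGTH CERTIFICATE OF THE RESIDUAL.** The band `FromFive` together with the dimension-`≤ 3` literature facts implies
resolution of singularities of EVERY reduced separated scheme of finite type over EVERY algebraically closed field of positive
characteristic, in all dimensions (`resolutionOverAlgClosed_of_equisingularLift`, p165577, through the PROVED crux
`HypersurfacesSuffice`): the residual of the line `sections` is summit-strength over `k̄`, by theorem. [folklore] -/
theorem resolutionOverAlgClosed_of_fromFive_of_CJS_CP (hCJS : CossartJannsenSaito2020Sequence.{0})
    (hCP : CossartPiltant2019General.{0}) (hPr : CossartPiltant2019Principalization.{0}) (h5 : ∀ p : ℕ, FromFive p) :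
    ∀ p : ℕ, p.Prime → ∀ (k : Type) [Field k] [CharP k p] [IsAlgClosed k] (X : AlgebraicGeometry.Scheme.{0})
      (f : X ⟶ AlgebraicGeometry.Spec (.of k)), AlgebraicGeometry.IsSeparated f → AlgebraicGeometry.LocallyOfFiniteType f →
      AlgebraicGeometry.QuasiCompact f → AlgebraicGeometry.IsReduced X →
      Literature.AlgebraicGeometry.Resolution.Scheme.HasResolution X :=
  resolutionOverAlgClosed_of_equisingularLift (equisingularLift_of_fromFive_of_CJS_CP hCJS hCP hPr h5)

/-! ## Alignment with the registered skeleton `sections` (elnat-v1, lead res-L1-w45b-lead-2): its residual stub is `Four ∧ FromFive` -/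

/-- **The registered residual stub `stub_elnat_ge_four` (text: the route decl at `p` with `4 ≤ n` inserted) follows from the two
upper bands** — so a lead who wants the residual cut at the Cossart–Piltant boundary can reshape `stub_elnat_ge_four` into
`stub_elnat_four := Four p` and `stub_elnat_ge_five := FromFive p` without touching `EquisingularLiftNat_of`. Pure logic. [folklore] -/
theorem stub_elnat_ge_four_of_bands (h4 : ∀ p : ℕ, Four p) (h5 : ∀ p : ℕ, FromFive p) (p : ℕ) :
    p.Prime → ∀ (k : Type) [Field k] [CharP k p] [IsAlgClosed k] (n : ℕ) (H : AlgebraicGeometry.Scheme.{0}) (ι : H ⟶ (Literature.AlgebraicGeometry.Motives.projectiveSpace n k).left), AlgebraicGeometry.IsClosedImmersion ι → AlgebraicGeometry.IsIntegral H → (∀ y : (Literature.AlgebraicGeometry.Motives.projectiveSpace n k).left, ∃ U : (Literature.AlgebraicGeometry.Motives.projectiveSpace n k).left.affineOpens, y ∈ (U : (Literature.AlgebraicGeometry.Motives.projectiveSpace n k).left.Opens) ∧ (ι.ker.ideal U).IsPrincipal) → 4 ≤ n → ∃ (O : Type) (_ : CommRing O) (_ : IsDomain O) (_ : IsDiscreteValuationRing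 O) (_ : CharZero O) (π : O →+* k), Function.Surjective π ∧ (letI := MvPolynomial.gradedAlgebra (σ := Fin (n + 1)) (R := O); letI := MvPolynomial.gradedAlgebra (σ := Fin (n + 1)) (R := k); ∀ (φ : MvPolynomial.homogeneousSubmodule (Fin (n + 1)) O →+*ᵍ MvPolynomial.homogeneousSubmodule (Fin (n + 1)) k) (hφ' : HomogeneousIdeal.irrelevant (MvPolynomial.homogeneousSubmodule (Fin (n + 1)) k) ≤ (HomogeneousIdeal.irrelevant (MvPolynomial.homogeneousSubmodule (Fin (n + 1)) O)).map φ), (∀ s, φ s = MvPolynomial.map π s) → ∀ Y : Set (AlgebraicGeometry.Proj (MvPolynomial.homogeneousSubmodule (Fin (n + 1)) O)), Y = Set.range (CategoryTheory.CategoryStruct.comp ι (AlgebraicGeometry.Proj.map φ hφ') : H ⟶ (AlgebraicGeometry.Proj (MvPolynomial.homogeneousSubmodule (Fin (n + 1)) O))) → ∃ (P' : AlgebraicGeometry.Scheme.{0}) (σ : P' ⟶ (AlgebraicGeometry.Proj (MvPolynomial.homogeneousSubmodule (Fin (n + 1)) O))) (S' : Set P'), (∀ Q : (∀ X' : AlgebraicGeometry.Scheme.{0},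 (X' ⟶ (AlgebraicGeometry.Proj (MvPolynomial.homogeneousSubmodule (Fin (n + 1)) O))) → Set X' → Prop), Q (AlgebraicGeometry.Proj (MvPolynomial.homogeneousSubmodule (Fin (n + 1)) O)) (CategoryTheory.CategoryStruct.id _) Y → (∀ (X' X'' : AlgebraicGeometry.Scheme.{0}) (σ' : X' ⟶ (AlgebraicGeometry.Proj (MvPolynomial.homogeneousSubmodule (Fin (n + 1)) O))) (Y' : Set X') (C : X'.IdealSheafData) (τ : X'' ⟶ X'), Q X' σ' Y' → Literature.AlgebraicGeometry.Resolution.IsBlowup τ C → Literature.AlgebraicGeometry.Resolution.Scheme.IsRegular C.subscheme → σ' '' (C.support : Set X') ⊆ {x | ¬ IsGenericPoint x Y} → (C.support : Set X') ∩ (CategoryTheory.CategoryStruct.comp σ' (CategoryTheory.CategoryStruct.comp (AlgebraicGeometry.Proj.toSpecZero (MvPolynomial.homogeneousSubmodule (Fin (n + 1)) O)) (AlgebraicGeometry.Spec.map (CommRingCat.ofHom (algebraMap O (MvPolynomial.homogeneousSubmodule (Fin (n + 1)) O 0)))))) ⁻¹' {IsLocalRing.closedPoint O} ⊆ Y' →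 Q X'' (CategoryTheory.CategoryStruct.comp τ σ') (closure (τ ⁻¹' (Y' \ (C.support : Set X'))))) → Q P' σ S') ∧ IsIrreducible ((CategoryTheory.CategoryStruct.comp σ (CategoryTheory.CategoryStruct.comp (AlgebraicGeometry.Proj.toSpecZero (MvPolynomial.homogeneousSubmodule (Fin (n + 1)) O)) (AlgebraicGeometry.Spec.map (CommRingCat.ofHom (algebraMap O (MvPolynomial.homogeneousSubmodule (Fin (n + 1)) O 0)))))) ⁻¹' {IsLocalRing.closedPoint O}) ∧ Literature.AlgebraicGeometry.Resolution.Scheme.IsRegular (AlgebraicGeometry.Scheme.IdealSheafData.vanishingIdeal (⟨closure S', isClosed_closure⟩ : TopologicalSpace.Closeds P')).subscheme) := by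
  intro hp k _ _ _ n H ι hι hH hloc hn
  rcases Nat.eq_or_lt_of_le hn with h | h
  · exact h4 p hp k n H ι hι hH hloc h.symm
  · exact h5 p hp k n H ι hι hH hloc (by omega)

end Summit.ResolutionOfSingularities.ResolutionOfSingularities.Theorems.EquisingularLiftNatBands

end
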